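import Literature.AlgebraicGeometry.ShimuraVarieties.BallQuotientUniformisedOf
import Literature.AlgebraicGeometry.ComplexMultiplication.CMAbelianVarietyRealisedHolds
import Literature.AlgebraicGeometry.ShimuraVarieties.CompactBallQuotientProjectiveEmbeddingProofs
import Literature.NumberTheory.Automorphic.PicardCMCompactUnitaryQuotient
import HarnessLib

/-!
# `PicardCM.BallQuotientUniformised` holds

The Literature named fact `PicardCM.BallQuotientUniformised` (the binder `h₁` of the COR-CM E term, via
`ballQuotientUniformisedDatum_of`) is a THEOREM, discharged here under its EXACT name — compact
arithmetic ball quotients `Γ\𝔹²` are smooth projective surfaces uniformised by the ball of negative lines, with the five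
clauses of `PicardCM.IsBallUniformisation`.  Assembly `ballQuotientUniformised_of_embedding` (`BallQuotientUniformisedOf.lean`:
K1 algebraisation of the projectively embedded compact complex surface `Δ\𝔹²`, X-free cone chart, lattice discontinuity
`UnitaryGroup.*_archImageU21_of_signature`) applied to the DISCHARGED record
`Literature.AlgebraicGeometry.ShimuraVarieties.compactBallQuotient_projectiveEmbedding_holds`
(`CompactBallQuotientProjectiveEmbeddingProofs.lean`: Poincaré series on `𝔹²` converge, separate points and tangents, and
embed `Δ\𝔹²` — Shafarevich BAG 2 IX §3.1–3.2 / Kollár 1995 Thm 5.22, proved in the tree by the cell's D4 seats).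

Provenance: Literature home (namespace `Literature.AlgebraicGeometry.ShimuraVarieties.BallQuotient`) of the Summits-side `HodgeConjecture/CorCM/Geometry/BallQuotientUniformisedHolds` (imports `Literature/` and Mathlib only), re-homed so that the Literature named facts it proves are discharged Literature-side under their exact names. Lane `lit-hodgefound`, seat p20.
-/

set_option autoImplicit false

noncomputable section

namespace Literature.AlgebraicGeometry.ShimuraVarieties.BallQuotient

/-- **`PicardCM.BallQuotientUniformised` holds** (discharge of the named fact
`Literature.NumberTheory.Automorphic.PicardCM.BallQuotientUniformised`, the binder `h₁`/`hU` of the COR-CM E term): for every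
CM field `E ⊂ ℂ`, hermitian anisotropic `H ∈ M₃(E)` of signature `(2,1)` at the distinguished place and definite elsewhere, and
torsion-free congruence subgroup `Γ` of `U(H)(E⁺)`, there is a smooth projective surface `X/ℂ` with a ball uniformisation of
`X(ℂ)` satisfying the five clauses of `IsBallUniformisation`.
[cite: Shafarevich1994, Book 3 Ch. IX §3.2 Theorem] [cite: Kollar1995, Ch. 5 Thm. 5.22]
[cite: Mumford1981, (4.6) Corollary, p. 61; (4.14) Corollary] -/
theorem _root_.Literature.NumberTheory.Automorphic.PicardCM.BallQuotientUniformised_holds :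
    Literature.NumberTheory.Automorphic.PicardCM.BallQuotientUniformised :=
  ballQuotientUniformised_of_embedding
    Literature.AlgebraicGeometry.ShimuraVarieties.compactBallQuotient_projectiveEmbedding_holds

/-!
## v2 (b10 gen 4, 2026-08-21): the packaged record `hU` and the prerequisite bundle

Append-only sequel.  (1) The PACKAGED form (ii-a′) `PicardCM.BallQuotientUniformisedDatum` of the record — the binder
`hU` of `Model.universeOf`, of the stage-1 model universe, of the Milne-1999 codes layer and of the CorCM cycle-class /
domination files — is a theorem by name.  (2)–(3) With (ii-a) proved, conjunct (ii) `PicardCM.BallQuotientAlgebraic`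
and the whole bundle `PicardCMPrerequisites` ((i) Godement compactness, (ii-a), (ii-b), (iii) CM abelian varieties of a
given CM type, (iv) Hecke characters of prescribed unitary archimedean type) follow from the special-cycle record
(ii-b) `PicardCM.SpecialCyclesAlgebraic` ALONE, the other four records being tree theorems
(`PicardCM.compactUnitaryQuotient_holds`, `ballQuotientUniformised_holds`,
`Literature.NumberTheory.Automorphic.PicardCM.CMAbelianVarietyRealised_holds`,
`Literature.NumberTheory.GaloisRepresentations.HeckeCharacter.exists_of_unitaryArchParams_iff_holds`).
-/

/-- **`PicardCM.BallQuotientUniformisedDatum` holds** (discharge of the packaged named fact (ii-a′)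
`Literature.NumberTheory.Automorphic.PicardCM.BallQuotientUniformisedDatum`, the binder `hU`): for every CM field
`E ⊂ ℂ`, hermitian anisotropic `H ∈ M₃(E)` of signature `(2,1)` at the distinguished place and definite elsewhere, and
torsion-free congruence subgroup `Γ` of `U(H)(E⁺)`, some smooth projective surface `X/ℂ` carries a
`UnitaryBallUniformisationDatum 2 X` with these `E`, `H`, `Γ`.  One line: the tree's repackaging
`PicardCM.ballQuotientUniformisedDatum_of` (the three identification clauses by `rfl`) applied to
`ballQuotientUniformised_holds`; in particular `Model.universeOf hHD hI Literature.NumberTheory.Automorphic.PicardCM.BallQuotientUniformisedDatum_holds h₃` and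
`Model.picardCMUniverse hHD hI Literature.NumberTheory.Automorphic.PicardCM.BallQuotientUniformised_holds h₃` are the same term.
[cite: Shafarevich1994, Book 3 Ch. IX §3.2 Theorem] [cite: GenestierNgo2020, Theorem 4.5.2] -/
theorem _root_.Literature.NumberTheory.Automorphic.PicardCM.BallQuotientUniformisedDatum_holds :
    Literature.NumberTheory.Automorphic.PicardCM.BallQuotientUniformisedDatum :=
  Literature.NumberTheory.Automorphic.PicardCM.ballQuotientUniformisedDatum_of Literature.NumberTheory.Automorphic.PicardCM.BallQuotientUniformised_holds

/-- **Conjunct (ii) `PicardCM.BallQuotientAlgebraic` from the special-cycle record (ii-b) alone**: with (ii-a)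
`BallQuotientUniformised` a theorem, the kernel packaging `PicardCM.ballQuotientAlgebraic_of` leaves
`PicardCM.SpecialCyclesAlgebraic` (special cycles of compact ball quotients are closed algebraic subvarieties of the
expected codimension) as the only input of (ii). [cite: KudlaMillson1990, Lemma 1.1, p. 128] -/
theorem ballQuotientAlgebraic_of_specialCyclesAlgebraic
    (h₂ : Literature.NumberTheory.Automorphic.PicardCM.SpecialCyclesAlgebraic) :
    Literature.NumberTheory.Automorphic.PicardCM.BallQuotientAlgebraic :=
  Literature.NumberTheory.Automorphic.PicardCM.ballQuotientAlgebraic_of Literature.NumberTheory.Automorphic.PicardCM.BallQuotientUniformised_holds h₂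

/-- **The Picard–CM prerequisite bundle `PicardCMPrerequisites` from (ii-b) alone.** Of its five theorem-numbered
records — (i) compactness of `U(H)(L⁺)\U(H)(𝔸)` for anisotropic `H`, (ii-a) ball-quotient uniformisation, (ii-b)
algebraicity of special cycles, (iii) CM abelian varieties of a given CM type, (iv) Hecke characters of prescribed
unitary archimedean type — all but (ii-b) are theorems of the tree, so the bundle follows from
`PicardCM.SpecialCyclesAlgebraic` (via `picardCMPrerequisites_of_geometry` and
`Literature.NumberTheory.Automorphic.PicardCM.CMAbelianVarietyRealised_holds`). [cite: KudlaMillson1990, Lemma 1.1, p. 128] -/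
theorem picardCMPrerequisites_of_specialCyclesAlgebraic
    (h₂ : Literature.NumberTheory.Automorphic.PicardCM.SpecialCyclesAlgebraic) :
    Literature.NumberTheory.Automorphic.PicardCMPrerequisites :=
  Literature.NumberTheory.Automorphic.picardCMPrerequisites_of_geometry
    (ballQuotientAlgebraic_of_specialCyclesAlgebraic h₂) Literature.NumberTheory.Automorphic.PicardCM.CMAbelianVarietyRealised_holds

end Literature.AlgebraicGeometry.ShimuraVarieties.BallQuotient

end
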